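import Mathlib.MeasureTheory.Integral.IntervalIntegral.TrapezoidalRule
import Mathlib.Analysis.Calculus.IteratedDeriv.Lemmas
import Mathlib.Analysis.SpecialFunctions.Gamma.Beta
import Mathlib.Analysis.SpecialFunctions.ImproperIntegrals
import Mathlib.MeasureTheory.Integral.IntegralEqImproper
import Literature.Analysis.SpecialFunctions.DigammaGauss
import Literature.NumberTheory.LFunctions.RiemannSiegelFacts
import Literature.NumberTheory.LFunctions.ZetaZerosReflection
import Literature.NumberTheory.LFunctions.ZeroCountingProofs
import HarnessLib

/-!
# Stirling's formula for the Riemann–Siegel theta function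

Trunk T-ANT (`NumberTheory/LFunctions`), family RH; sibling of `RiemannSiegel.lean`, which *defines*
`θ(t) = ∫₀ᵗ (Re ψ(¼ + iu/2)/2 − (log π)/2) du` (D-ANT-3: the continuous branch of
`Im log Γ(¼ + it/2) − (t/2) log π` as the integral of its derivative) and records Stirling's formula
`θ(t) = (t/2) log(t/2π) − t/2 − π/8 + O(1/t)` (Titchmarsh §4.17; Edwards §6.5, (6.5.3)) as the
named fact `Literature.NumberTheory.LFunctions.isBigO_riemannSiegelTheta_sub_stirling`. Mathlib has no Stirling formula for the
complex `Γ`-function; this file proves the named fact (`isBigO_riemannSiegelTheta_sub_stirling_holds`,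
with the explicit `abs_riemannSiegelTheta_sub_stirling_le`) and hence Backlund's refinement
`Literature.NumberTheory.LFunctions.isBigO_zetaZeroCount_sub_backlund` of the Riemann–von Mangoldt formula
(`ZeroCounting.lean`; `isBigO_zetaZeroCount_sub_backlund_holds`), by an argument that needs only
the *first two* terms of Stirling's series for `Re ψ` and pins the constant `−π/8` down
algebraically:

* `Literature.NumberTheory.LFunctions.Complex.abs_re_digamma_sub_log_norm_add_re_le` — **second-order Stirling bound on vertical
  lines**: `|Re ψ(w) − log ‖w‖ + Re 1/(2w)| ≤ 1/(6|Im w|³) + π/(12 (Im w)²)` (`Re w > 0`), from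
  Gauss's formula `ψ(w) = lim (log n − Σ_{j≤n} 1/(w+j))` (`DigammaGauss.lean`) by the *trapezoid*
  rule on each `[k, k+1]` (Mathlib `trapezoidal_error_le`; the tree's first-order bound
  `abs_re_digamma_sub_log_norm_le` is the left-endpoint rule);
* `Literature.NumberTheory.LFunctions.Complex.digamma_add_digamma_add_half`, `Literature.NumberTheory.LFunctions.Complex.digamma_sub_digamma_one_sub` —
  Legendre duplication `ψ(s) + ψ(s+½) = 2ψ(2s) − 2 log 2` and reflection
  `ψ(s) − ψ(1−s) = −π cot(πs)` (logarithmic derivatives of Mathlib's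
  `Complex.Gamma_mul_Gamma_add_half`, `Complex.Gamma_mul_Gamma_one_sub`);
* `Literature.argGammaVert σ τ = ∫₀^τ Re ψ(σ+iu) du` — the continuous `arg Γ(σ+iτ)` on the vertical line
  through `σ > 0` (so `θ(t) = argGammaVert ¼ (t/2) − (t/2) log π`,
  `riemannSiegelTheta_eq_argGammaVert`), with the exact duplication and reflection identities
  `argGammaVert_add_argGammaVert_add_half`, `argGammaVert_sub_argGammaVert_one_sub`;
* `Literature.NumberTheory.LFunctions.abs_argGammaVert_sub_stirling_le` — `|arg Γ(σ+iτ) − (τ log τ − τ) − c(σ)| ≤ K(σ)/τ`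
  (`τ ≥ 1`) with `c(σ) = Literature.stirlingArgConst σ` (defined by an absolutely convergent integral of
  the remainder `Re ψ(σ+iu) − log u = O(1/u²)`) and `K(σ) = Literature.stirlingVertRate σ`;
* the constants: `c(σ) + c(σ+½) = c(2σ)` and `c(¼) − c(¾) = −π/4` (`arg sin(π(¼+iτ)) → π/4`), whence
  `c(½) = 0` and **`c(¼) = −π/8`** (`stirlingArgConst_one_quarter`) — i.e. Stirling's
  `arg Γ(σ+iτ) = τ log τ − τ + (σ − ½)π/2 + O(1/τ)` at `σ = ¼` without Stirling's constant `√(2π)`.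

## References

* E. C. Titchmarsh, *The Theory of the Riemann Zeta-Function*, 2nd ed. (1986), §4.17; *The Theory
  of Functions*, 2nd ed. (1939), §4.42 (Stirling for `log Γ` in a sector).
* H. M. Edwards, *Riemann's Zeta Function* (1974), §6.5, eq. (6.5.3).
* E. T. Whittaker, G. N. Watson, *A Course of Modern Analysis*, 4th ed., §12.33 (`ψ` expansion),
  §12.14–12.15 (reflection, duplication), §13.6.
* G. E. Andrews, R. Askey, R. Roy, *Special Functions* (1999), Thm. 1.2.5 (Gauss's formula).
-/

noncomputable section

open Complex Real Set Filter Topology MeasureTheory intervalIntegral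
open scoped ComplexConjugate

namespace Literature.NumberTheory.LFunctions.Complex

/-! ### The kernel `u ↦ Re 1/(w+u)` and its first two derivatives -/

/-- Derivative of `u ↦ 1/(w+u)` along the reals. [folklore] -/
lemma hasDerivAt_one_div_add_ofReal {w : ℂ} {u : ℝ} (h : w + u ≠ 0) :
    HasDerivAt (fun u : ℝ ↦ 1 / (w + u)) (-1 / (w + u) ^ 2) u := by
  have h1 : HasDerivAt (fun z : ℂ ↦ w + z) 1 (u : ℂ) := (hasDerivAt_id (u : ℂ)).const_add w
  have h3 : HasDerivAt (fun z : ℂ ↦ 1 / (w + z)) (-1 / (w + u) ^ 2) (u : ℂ) := by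
    have h2 := (hasDerivAt_const (u : ℂ) (1 : ℂ)).div h1 h
    exact h2.congr_deriv (by ring)
  exact h3.comp_ofReal

/-- Derivative of `u ↦ -1/(w+u)²` along the reals. [folklore] -/
lemma hasDerivAt_neg_one_div_sq_add_ofReal {w : ℂ} {u : ℝ} (h : w + u ≠ 0) :
    HasDerivAt (fun u : ℝ ↦ -1 / (w + u) ^ 2) (2 / (w + u) ^ 3) u := by
  have h1 : HasDerivAt (fun z : ℂ ↦ w + z) 1 (u : ℂ) := (hasDerivAt_id (u : ℂ)).const_add w
  have h2 : HasDerivAt (fun z : ℂ ↦ (w + z) ^ 2) (((2 : ℕ) : ℂ) * (w + u) ^ (2 - 1) * 1) (u : ℂ) :=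
    h1.pow 2
  have h4 : HasDerivAt (fun z : ℂ ↦ -1 / (w + z) ^ 2) (2 / (w + u) ^ 3) (u : ℂ) := by
    have h3 := (hasDerivAt_const (u : ℂ) (-1 : ℂ)).div h2 (pow_ne_zero 2 h)
    refine h3.congr_deriv ?_
    field_simp
    push_cast
    ring
  exact h4.comp_ofReal

/-- Real parts: `(Re f)' = Re f'` for `f : ℝ → ℂ`. [folklore] -/
lemma hasDerivAt_re_comp {f : ℝ → ℂ} {f' : ℂ} {u : ℝ} (hf : HasDerivAt f f' u) :
    HasDerivAt (fun u ↦ (f u).re) f'.re u := by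
  exact reCLM.hasFDerivAt.comp_hasDerivAt u hf

/-- The kernel `g_w(u) = Re 1/(w+u)` is smooth on `ℝ` when `Im w ≠ 0`. [folklore] -/
lemma contDiff_re_one_div_add {w : ℂ} (hy : w.im ≠ 0) {n : WithTop ℕ∞} :
    ContDiff ℝ n (fun u : ℝ ↦ (1 / (w + u)).re) := by
  have hfun : (fun u : ℝ ↦ (1 / (w + u)).re) = fun u ↦ (w.re + u) / ((w.re + u) ^ 2 + w.im ^ 2) :=
    funext fun u ↦ Literature.Analysis.SpecialFunctions.Complex.re_one_div_add_ofReal w u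
  rw [hfun]
  refine ContDiff.div (by fun_prop) (by fun_prop) fun u ↦ ?_
  have : 0 < w.im ^ 2 := by positivity
  positivity

/-- `w + u ≠ 0` for real `u` when `Im w ≠ 0`. [folklore] -/
lemma add_ofReal_ne_zero {w : ℂ} (hy : w.im ≠ 0) (u : ℝ) : w + u ≠ 0 := fun h ↦ by
  have := congrArg Complex.im h
  simp at this
  exact hy this

/-- `g_w' = Re (-1/(w+u)²)`. [folklore] -/
lemma deriv_re_one_div_add {w : ℂ} (hy : w.im ≠ 0) :
    deriv (fun u : ℝ ↦ (1 / (w + u)).re) = fun u ↦ (-1 / (w + u) ^ 2).re :=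
  funext fun u ↦ (hasDerivAt_re_comp (hasDerivAt_one_div_add_ofReal (add_ofReal_ne_zero hy u))).deriv

/-- `g_w'' = Re (2/(w+u)³)`. [folklore] -/
lemma iteratedDeriv_two_re_one_div_add {w : ℂ} (hy : w.im ≠ 0) :
    iteratedDeriv 2 (fun u : ℝ ↦ (1 / (w + u)).re) = fun u ↦ (2 / (w + u) ^ 3).re := by
  rw [iteratedDeriv_succ, iteratedDeriv_one, deriv_re_one_div_add hy]
  exact funext fun u ↦
    (hasDerivAt_re_comp (hasDerivAt_neg_one_div_sq_add_ofReal (add_ofReal_ne_zero hy u))).deriv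

/-- `‖w + u‖` is non-decreasing in `u ≥ 0` for `Re w > 0`. [folklore] -/
lemma norm_add_ofReal_mono {w : ℂ} (hw : 0 < w.re) {j u : ℝ} (hj : 0 ≤ j) (hju : j ≤ u) :
    ‖w + j‖ ≤ ‖w + u‖ := by
  have h1 : ‖w + j‖ ^ 2 ≤ ‖w + u‖ ^ 2 := by
    rw [Literature.Analysis.SpecialFunctions.Complex.norm_add_ofReal_sq, Literature.Analysis.SpecialFunctions.Complex.norm_add_ofReal_sq]
    nlinarith
  exact (pow_le_pow_iff_left₀ (norm_nonneg _) (norm_nonneg _) two_ne_zero).1 h1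

/-- **Trapezoid error on one unit interval**: for `Re w > 0`, `Im w ≠ 0`, `k ≥ 0`,
`|(g(k) + g(k+1))/2 − ∫ₖ^{k+1} g| ≤ 1/(6 ‖w+k‖³)` for `g(u) = Re 1/(w+u)` (`|g''| ≤ 2/‖w+k‖³` on
`[k, k+1]` and Mathlib's `trapezoidal_error_le`). [folklore] -/
lemma abs_trapezoid_re_one_div_le {w : ℂ} (hw : 0 < w.re) (hy : w.im ≠ 0) {k : ℝ} (hk : 0 ≤ k) :
    |((1 / (w + k)).re + (1 / (w + (k + 1 : ℝ))).re) / 2 -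
        ∫ u in k..(k + 1), (1 / (w + u)).re| ≤ 1 / (6 * ‖w + k‖ ^ 3) := by
  set g : ℝ → ℝ := fun u ↦ (1 / (w + u)).re with hg
  have hcd : ContDiff ℝ 2 g := contDiff_re_one_div_add hy
  have hpos : 0 < ‖w + k‖ := Literature.Analysis.SpecialFunctions.Complex.norm_add_ofReal_pos hw hk
  have hbound : ∀ x, |iteratedDerivWithin 2 g (uIcc k (k + 1)) x| ≤ 2 / ‖w + k‖ ^ 3 := by
    intro x
    rw [uIcc_of_le (by linarith)]
    by_cases hx : x ∈ Icc k (k + 1)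
    · rw [iteratedDerivWithin_eq_iteratedDeriv (uniqueDiffOn_Icc (by linarith)) hcd.contDiffAt hx,
        iteratedDeriv_two_re_one_div_add hy]
      have hxk : ‖w + k‖ ≤ ‖w + x‖ := norm_add_ofReal_mono hw hk hx.1
      have hx0 : 0 < ‖w + x‖ := hpos.trans_le hxk
      calc |(2 / (w + x) ^ 3).re| ≤ ‖2 / (w + x) ^ 3‖ := abs_re_le_norm _
        _ = 2 / ‖w + x‖ ^ 3 := by simp [norm_pow]
        _ ≤ 2 / ‖w + k‖ ^ 3 := by
          apply div_le_div_of_nonneg_left (by norm_num) (by positivity)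
          exact pow_le_pow_left₀ hpos.le hxk 3
    · rw [iteratedDerivWithin_succ, derivWithin_zero_of_notMem_closure (by rwa [closure_Icc]),
        abs_zero]
      positivity
  have h := trapezoidal_error_le (f := g) (a := k) (b := k + 1)
    (hcd.differentiable (by norm_num)).differentiableOn ?_ hbound (N := 1) one_pos
  · rw [trapezoidal_error, trapezoidal_integral_one] at h
    have e : |k + 1 - k| ^ 3 * (2 / ‖w + k‖ ^ 3) / (12 * (1 : ℕ) ^ 2) = 1 / (6 * ‖w + k‖ ^ 3) := by
      norm_num; ring
    rw [e] at h
    convert h using 2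
    simp [hg]
    ring
  · -- differentiability of derivWithin on the interval
    rw [uIcc_of_le (by linarith)]
    have hd : Differentiable ℝ (deriv g) := by
      have := hcd.differentiable_iteratedDeriv 1 (by norm_num)
      rwa [iteratedDeriv_one] at this
    intro x hx
    have heq : EqOn (derivWithin g (Icc k (k + 1))) (deriv g) (Icc k (k + 1)) := fun y hy ↦
      (hcd.differentiable (by norm_num) y).derivWithin (uniqueDiffOn_Icc (by linarith) y hy)
    exact ((hd x).differentiableWithinAt).congr heq (heq hx)

/-! ### The second-order bound -/

/-- Trapezoid bookkeeping: `Σ_{j ≤ n} g(j) = Σ_{k < n} (g(k) + g(k+1))/2 + (g(0) + g(n))/2`. [folklore] -/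
lemma sum_range_succ_eq_sum_trapezoid (g : ℕ → ℝ) (n : ℕ) :
    ∑ j ∈ Finset.range (n + 1), g j =
      ∑ k ∈ Finset.range n, (g k + g (k + 1)) / 2 + (g 0 + g n) / 2 := by
  induction n with
  | zero => simp
  | succ n ih =>
    rw [Finset.sum_range_succ, ih, Finset.sum_range_succ]
    ring

/-- **Second-order Stirling bound for `Re ψ` on vertical lines.** For `0 < Re w`, `Im w ≠ 0`:
`|Re ψ(w) − log ‖w‖ + Re (1/(2w))| ≤ 1/(6|Im w|³) + π/(12 (Im w)²)`.
From Gauss's formula `ψ(w) = lim (log n − Σ_{j≤n} 1/(w+j))` (`tendsto_log_sub_sum_inv_digamma`),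
comparing `Σ_{j≤n} Re 1/(w+j)` with `∫₀ⁿ Re 1/(w+u) du = log‖w+n‖ − log‖w‖` by the *trapezoid* rule
on each `[k, k+1]` (error `≤ 1/(6‖w+k‖³)`, `abs_trapezoid_re_one_div_le`), the end-point correction
`g(0)/2 = Re 1/(2w)` being the second Stirling term; cf. the first-order
`abs_re_digamma_sub_log_norm_le` (left-endpoint rule). (Whittaker–Watson §12.33 / §13.6 give the
full expansion `ψ(w) = log w − 1/(2w) − Σ B_{2k}/(2k w^{2k})`.) [folklore] -/
theorem abs_re_digamma_sub_log_norm_add_re_le {w : ℂ} (hw : 0 < w.re) (hy : w.im ≠ 0) :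
    |(digamma w).re - Real.log ‖w‖ + (1 / (2 * w)).re| ≤
      1 / (6 * |w.im| ^ 3) + π / (12 * w.im ^ 2) := by
  set g : ℝ → ℝ := fun u ↦ (1 / (w + u)).re with hg
  set B : ℝ := 1 / (6 * |w.im| ^ 3) + π / (12 * w.im ^ 2) with hB
  have hτ : 0 < |w.im| := abs_pos.2 hy
  -- real part of Gauss's formula
  have ha : Tendsto (fun n : ℕ ↦ Real.log n - ∑ j ∈ Finset.range (n + 1), g j) atTop
      (𝓝 (digamma w).re) := by
    have := (continuous_re.tendsto _).comp (Literature.Analysis.SpecialFunctions.Complex.tendsto_log_sub_sum_inv_digamma hw)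
    refine this.congr fun n ↦ ?_
    simp only [Function.comp_apply, Complex.sub_re, Complex.ofReal_re, Complex.re_sum, g,
      Complex.ofReal_natCast]
  -- the comparison sequence
  set c : ℕ → ℝ := fun n ↦ Real.log n - Real.log ‖w + n‖ + Real.log ‖w‖ - (g 0 + g n) / 2 with hc
  have hgn : Tendsto (fun n : ℕ ↦ g n) atTop (𝓝 0) := by
    have hle : ∀ n : ℕ, |g n| ≤ 1 / (w.re + n) := by
      intro n
      simp only [hg, Literature.Analysis.SpecialFunctions.Complex.re_one_div_add_ofReal]
      have hpos : 0 < w.re + n := by positivity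
      rw [abs_of_nonneg (div_nonneg hpos.le (by positivity)), div_le_div_iff₀ (by positivity) hpos]
      nlinarith [sq_nonneg w.im]
    have hlim : Tendsto (fun n : ℕ ↦ 1 / (w.re + n)) atTop (𝓝 0) := by
      refine tendsto_const_nhds.div_atTop ?_
      exact tendsto_atTop_add_const_left _ _ tendsto_natCast_atTop_atTop
    exact squeeze_zero_norm (fun n ↦ by simpa [Real.norm_eq_abs] using hle n) hlim
  have hcl : Tendsto c atTop (𝓝 (Real.log ‖w‖ - g 0 / 2)) := by
    have h1 := ((Literature.Analysis.SpecialFunctions.Complex.tendsto_log_nat_sub_log_norm_add w).add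
      (tendsto_const_nhds (x := Real.log ‖w‖))).sub (((tendsto_const_nhds (x := g 0)).add hgn).div_const 2)
    have e : (0 + Real.log ‖w‖ - (g 0 + 0) / 2) = Real.log ‖w‖ - g 0 / 2 := by ring
    rw [e] at h1
    refine h1.congr fun n ↦ ?_
    simp only [hc]
  -- the key estimate
  have hkey : ∀ n : ℕ, |(Real.log n - ∑ j ∈ Finset.range (n + 1), g j) - c n| ≤ B := by
    intro n
    have hint : ∀ k < n, IntervalIntegrable g volume (k : ℕ) ((k + 1 : ℕ) : ℝ) := by
      intro k _
      exact ((contDiff_re_one_div_add (n := 0) hy).continuous).intervalIntegrable _ _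
    have hsum : ∑ k ∈ Finset.range n, ∫ u in (k : ℕ)..((k + 1 : ℕ) : ℝ), g u =
        Real.log ‖w + n‖ - Real.log ‖w‖ := by
      rw [intervalIntegral.sum_integral_adjacent_intervals hint, Nat.cast_zero]
      have h0 := Literature.Analysis.SpecialFunctions.Complex.integral_re_one_div_add hw le_rfl (Nat.cast_nonneg n)
      rw [Complex.ofReal_natCast, Complex.ofReal_zero, add_zero] at h0
      exact h0
    have hrew : (Real.log n - ∑ j ∈ Finset.range (n + 1), g j) - c n =
        -∑ k ∈ Finset.range n, ((g k + g (k + 1)) / 2 - ∫ u in (k : ℕ)..((k + 1 : ℕ) : ℝ), g u) := by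
      rw [Finset.sum_sub_distrib, hsum, sum_range_succ_eq_sum_trapezoid (fun j ↦ g j) n, hc]
      simp only [Nat.cast_add, Nat.cast_one]
      push_cast
      ring
    rw [hrew, abs_neg]
    have hwτ : |w.im| ≤ ‖w‖ := abs_im_le_norm w
    calc |∑ k ∈ Finset.range n, ((g k + g (k + 1)) / 2 - ∫ u in (k : ℕ)..((k + 1 : ℕ) : ℝ), g u)|
        ≤ ∑ k ∈ Finset.range n, |(g k + g (k + 1)) / 2 - ∫ u in (k : ℕ)..((k + 1 : ℕ) : ℝ), g u| :=
          Finset.abs_sum_le_sum_abs _ _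
      _ ≤ ∑ k ∈ Finset.range n, 1 / (6 * ‖w + k‖ ^ 3) := by
          refine Finset.sum_le_sum fun k _ ↦ ?_
          have := abs_trapezoid_re_one_div_le hw hy (Nat.cast_nonneg k)
          simpa [hg] using this
      _ ≤ ∑ k ∈ Finset.range n, (1 / (6 * |w.im|)) * (1 / ‖w + k‖ ^ 2) := by
          refine Finset.sum_le_sum fun k _ ↦ ?_
          have hk : |w.im| ≤ ‖w + k‖ := by
            have := abs_im_le_norm (w + k)
            simpa using this
          have hpos : 0 < ‖w + k‖ := hτ.trans_le hk
          rw [div_mul_div_comm, one_mul, pow_succ, div_le_div_iff₀ (by positivity) (by positivity)]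
          nlinarith [pow_pos hpos 2]
      _ = (1 / (6 * |w.im|)) * ∑ k ∈ Finset.range n, 1 / ‖w + k‖ ^ 2 := by rw [Finset.mul_sum]
      _ ≤ (1 / (6 * |w.im|)) * (1 / ‖w‖ ^ 2 + π / (2 * |w.im|)) := by
          gcongr
          exact Literature.Analysis.SpecialFunctions.Complex.sum_inv_norm_add_sq_le hw hy n
      _ ≤ (1 / (6 * |w.im|)) * (1 / |w.im| ^ 2 + π / (2 * |w.im|)) := by
          gcongr
      _ = B := by
          have ht2 : w.im ^ 2 = |w.im| ^ 2 := (sq_abs _).symm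
          rw [hB, ht2]
          field_simp
          ring
  -- pass to the limit
  have hlim := (ha.sub hcl).abs
  have hfinal : |(digamma w).re - (Real.log ‖w‖ - g 0 / 2)| ≤ B := le_of_tendsto' hlim hkey
  have hg0 : g 0 / 2 = (1 / (2 * w)).re := by
    simp only [hg, Complex.ofReal_zero, add_zero]
    rw [show (1 : ℂ) / (2 * w) = ((1 / 2 : ℝ) : ℂ) * (1 / w) by push_cast; ring, re_ofReal_mul]
    ring
  rw [← hg0]
  convert hfinal using 2
  ring

/-! ### Duplication and reflection for `ψ` -/

/-- **Legendre's duplication formula for `ψ`**: `ψ(s) + ψ(s + ½) = 2ψ(2s) − 2 log 2` for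
`Re s > 0` (logarithmic derivative of `Γ(s)Γ(s+½) = Γ(2s) 2^{1−2s} √π`,
`Complex.Gamma_mul_Gamma_add_half`). [folklore] -/
theorem digamma_add_digamma_add_half {s : ℂ} (hs : 0 < s.re) :
    digamma s + digamma (s + 1 / 2) = 2 * digamma (2 * s) - 2 * Real.log 2 := by
  have hfun : (fun z : ℂ ↦ Complex.Gamma z * Complex.Gamma (z + 1 / 2)) =
      fun z ↦ Complex.Gamma (2 * z) * (2 : ℂ) ^ (1 - 2 * z) * (Real.sqrt π : ℂ) :=
    funext Complex.Gamma_mul_Gamma_add_half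
  have hs' : 0 < (s + 1 / 2).re := by simp; linarith
  have hs2 : 0 < (2 * s).re := by simp; linarith
  have hdΓ : ∀ {z : ℂ}, 0 < z.re → DifferentiableAt ℂ Complex.Gamma z := fun hz ↦
    Complex.differentiableAt_Gamma _ (Literature.NumberTheory.LFunctions.ne_neg_nat_of_re_pos hz)
  have h2 : (2 : ℂ) ≠ 0 := two_ne_zero
  have hsqrt : (Real.sqrt π : ℂ) ≠ 0 := by
    exact_mod_cast (Real.sqrt_pos.2 Real.pi_pos).ne'
  have hcpow : (2 : ℂ) ^ (1 - 2 * s) ≠ 0 := by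
    rw [Ne, cpow_eq_zero_iff]; simp
  have hΓs : Complex.Gamma s ≠ 0 := Complex.Gamma_ne_zero_of_re_pos hs
  have hΓs' : Complex.Gamma (s + 1 / 2) ≠ 0 := Complex.Gamma_ne_zero_of_re_pos hs'
  have hΓ2s : Complex.Gamma (2 * s) ≠ 0 := Complex.Gamma_ne_zero_of_re_pos hs2
  -- derivatives of the composed Gamma factors
  have hdA := (hdΓ hs').hasDerivAt.comp_add_const s (1 / 2)
  have hinner : HasDerivAt (fun z : ℂ ↦ 2 * z) 2 s := by
    simpa using (hasDerivAt_id s).const_mul (2 : ℂ)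
  have hdB : HasDerivAt (fun z : ℂ ↦ Complex.Gamma (2 * z)) (deriv Complex.Gamma (2 * s) * 2) s :=
    (hdΓ hs2).hasDerivAt.comp s hinner
  -- logDeriv of the left-hand side
  have hL : logDeriv (fun z : ℂ ↦ Complex.Gamma z * Complex.Gamma (z + 1 / 2)) s =
      digamma s + digamma (s + 1 / 2) := by
    rw [logDeriv_mul s hΓs hΓs' (hdΓ hs) hdA.differentiableAt]
    congr 1
    rw [logDeriv_apply, hdA.deriv, Complex.digamma_def, logDeriv_apply]
  -- logDeriv of the right-hand side
  have hR : logDeriv (fun z : ℂ ↦ Complex.Gamma (2 * z) * (2 : ℂ) ^ (1 - 2 * z) * (Real.sqrt π : ℂ)) s =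
      2 * digamma (2 * s) - 2 * Real.log 2 := by
    rw [logDeriv_mul_const s _ hsqrt]
    have hd2 : HasDerivAt (fun z : ℂ ↦ (2 : ℂ) ^ (1 - 2 * z))
        ((2 : ℂ) ^ (1 - 2 * s) * Complex.log 2 * (-2)) s := by
      have : HasDerivAt (fun z : ℂ ↦ 1 - 2 * z) (-2) s := by
        simpa using ((hasDerivAt_id s).const_mul (2 : ℂ)).const_sub 1
      exact this.const_cpow (Or.inl h2)
    rw [logDeriv_mul s hΓ2s hcpow hdB.differentiableAt hd2.differentiableAt]
    have e1 : logDeriv (fun z : ℂ ↦ Complex.Gamma (2 * z)) s = 2 * digamma (2 * s) := by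
      rw [logDeriv_apply, hdB.deriv, Complex.digamma_def, logDeriv_apply]
      ring
    have e2 : logDeriv (fun z : ℂ ↦ (2 : ℂ) ^ (1 - 2 * z)) s = -2 * Real.log 2 := by
      rw [logDeriv_apply, hd2.deriv, ← Complex.ofReal_ofNat, ← Complex.ofReal_log (by norm_num)]
      push_cast
      field_simp
    rw [e1, e2]
    ring
  rw [← hL, hfun, hR]

/-- **The reflection formula for `ψ`**: `ψ(s) − ψ(1 − s) = −π cos(πs)/sin(πs)` for `0 < Re s < 1`
(logarithmic derivative of `Γ(s)Γ(1−s) = π / sin(πs)`, `Complex.Gamma_mul_Gamma_one_sub`).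
[folklore] -/
theorem digamma_sub_digamma_one_sub {s : ℂ} (h0 : 0 < s.re) (h1 : s.re < 1) :
    digamma s - digamma (1 - s) = -(π * Complex.cos (π * s) / Complex.sin (π * s)) := by
  have hfun : (fun z : ℂ ↦ Complex.Gamma z * Complex.Gamma (1 - z)) =
      fun z ↦ (π : ℂ) / Complex.sin (π * z) :=
    funext Complex.Gamma_mul_Gamma_one_sub
  have h1' : 0 < (1 - s).re := by simp; linarith
  have hdΓ : ∀ {z : ℂ}, 0 < z.re → DifferentiableAt ℂ Complex.Gamma z := fun hz ↦
    Complex.differentiableAt_Gamma _ (Literature.NumberTheory.LFunctions.ne_neg_nat_of_re_pos hz)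
  have hΓs : Complex.Gamma s ≠ 0 := Complex.Gamma_ne_zero_of_re_pos h0
  have hΓ1s : Complex.Gamma (1 - s) ≠ 0 := Complex.Gamma_ne_zero_of_re_pos h1'
  have hsin : Complex.sin (π * s) ≠ 0 := by
    have hprod := Complex.Gamma_mul_Gamma_one_sub s
    intro h
    rw [h, div_zero] at hprod
    exact mul_ne_zero hΓs hΓ1s hprod
  have hπ : (π : ℂ) ≠ 0 := by exact_mod_cast Real.pi_ne_zero
  have hinner : HasDerivAt (fun z : ℂ ↦ 1 - z) (-1) s := by
    simpa using (hasDerivAt_id s).const_sub (1 : ℂ)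
  have hdA : HasDerivAt (fun z : ℂ ↦ Complex.Gamma (1 - z)) (deriv Complex.Gamma (1 - s) * -1) s :=
    (hdΓ h1').hasDerivAt.comp s hinner
  have hL : logDeriv (fun z : ℂ ↦ Complex.Gamma z * Complex.Gamma (1 - z)) s =
      digamma s - digamma (1 - s) := by
    rw [logDeriv_mul s hΓs hΓ1s (hdΓ h0) hdA.differentiableAt]
    rw [sub_eq_add_neg]
    congr 1
    rw [logDeriv_apply, hdA.deriv, Complex.digamma_def, logDeriv_apply]
    ring
  have hR : logDeriv (fun z : ℂ ↦ (π : ℂ) / Complex.sin (π * z)) s =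
      -(π * Complex.cos (π * s) / Complex.sin (π * s)) := by
    have hin : HasDerivAt (fun z : ℂ ↦ (π : ℂ) * z) π s := by
      simpa using (hasDerivAt_id s).const_mul (π : ℂ)
    have h1 : HasDerivAt (fun z : ℂ ↦ Complex.sin (π * z)) (Complex.cos (π * s) * π) s :=
      (Complex.hasDerivAt_sin (π * s)).comp s hin
    have hd : HasDerivAt (fun z : ℂ ↦ (π : ℂ) / Complex.sin (π * z))
        ((0 * Complex.sin (π * s) - π * (Complex.cos (π * s) * π)) / Complex.sin (π * s) ^ 2) s :=
      (hasDerivAt_const s (π : ℂ)).div h1 hsin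
    rw [logDeriv_apply, hd.deriv]
    field_simp
    ring
  rw [← hL, hfun, hR]

end Literature.NumberTheory.LFunctions.Complex

namespace Literature.NumberTheory.LFunctions

open LFunctions.Complex Literature.Analysis.SpecialFunctions.Complex

/-! ### The continuous argument of `Γ` along vertical lines -/

/-- `argGammaVert σ τ = arg Γ(σ + iτ)`, the continuous branch along the vertical line through
`σ > 0` normalised by `arg Γ(σ) = 0`, *defined* (as the tree defines `θ`, D-ANT-3) as the integral
of its derivative `Re ψ(σ + iu)` (`d/du Im log Γ(σ+iu) = Re Γ'/Γ(σ+iu)`):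
`argGammaVert σ τ := ∫₀^τ Re ψ(σ + iu) du`. In particular `θ(t) = argGammaVert ¼ (t/2) − (t/2) log π`
(`riemannSiegelTheta_eq_argGammaVert`). (Titchmarsh §4.17; Edwards §6.5.) [folklore] -/
def argGammaVert (σ τ : ℝ) : ℝ :=
  ∫ u in (0 : ℝ)..τ, (digamma (σ + u * I)).re

/-- `argGammaVert σ 0 = 0`. [folklore] -/
@[simp] theorem argGammaVert_zero (σ : ℝ) : argGammaVert σ 0 = 0 := by
  simp [argGammaVert]

/-- The integrand `u ↦ Re ψ(σ + iu)` is continuous for `σ > 0`. [folklore] -/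
theorem continuous_re_digamma_vertical {σ : ℝ} (hσ : 0 < σ) :
    Continuous fun u : ℝ ↦ (digamma (σ + u * I)).re := by
  refine continuous_iff_continuousAt.2 fun u ↦ ?_
  have h : ContinuousAt digamma ((σ : ℂ) + u * I) := continuousAt_digamma_of_re_pos (by simpa using hσ)
  have hc : Continuous fun u : ℝ ↦ (σ : ℂ) + u * I := by fun_prop
  have h2 : ContinuousAt (fun u : ℝ ↦ digamma ((σ : ℂ) + u * I)) u :=
    h.comp (f := fun u : ℝ ↦ (σ : ℂ) + u * I) hc.continuousAt
  exact continuous_re.continuousAt.comp h2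

/-- `d/dτ argGammaVert σ τ = Re ψ(σ + iτ)` (`σ > 0`). [folklore] -/
theorem hasDerivAt_argGammaVert {σ : ℝ} (hσ : 0 < σ) (τ : ℝ) :
    HasDerivAt (argGammaVert σ) ((digamma (σ + τ * I)).re) τ := by
  unfold argGammaVert
  exact intervalIntegral.integral_hasDerivAt_right
    ((continuous_re_digamma_vertical hσ).intervalIntegrable _ _)
    ((continuous_re_digamma_vertical hσ).stronglyMeasurableAtFilter _ _)
    (continuous_re_digamma_vertical hσ).continuousAt

/-- `argGammaVert σ` is differentiable (`σ > 0`). [folklore] -/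
theorem differentiable_argGammaVert {σ : ℝ} (hσ : 0 < σ) : Differentiable ℝ (argGammaVert σ) :=
  fun τ ↦ (hasDerivAt_argGammaVert hσ τ).differentiableAt

/-- **`θ(t) = arg Γ(¼ + it/2) − (t/2) log π`** in terms of `argGammaVert`: by the tree's definition
`θ(t) = ∫₀ᵗ (Re ψ(¼ + iu/2)/2 − (log π)/2) du` and the substitution `u = 2v`. [folklore] -/
theorem riemannSiegelTheta_eq_argGammaVert (t : ℝ) :
    riemannSiegelTheta t = argGammaVert (1 / 4) (t / 2) - t / 2 * Real.log π := by
  have hc : Continuous fun u : ℝ ↦ (digamma (1 / 4 + u / 2 * I)).re := by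
    have := (continuous_re_digamma_vertical (σ := 1 / 4) (by norm_num)).comp
      (continuous_id.div_const (2 : ℝ))
    refine this.congr fun u ↦ ?_
    simp only [Function.comp_apply, id_eq]
    push_cast
    ring_nf
  simp only [riemannSiegelTheta, riemannSiegelThetaDeriv, argGammaVert]
  rw [intervalIntegral.integral_sub ((hc.div_const 2).intervalIntegrable _ _)
    (continuous_const.intervalIntegrable _ _), intervalIntegral.integral_const,
    intervalIntegral.integral_div]
  have hsub := intervalIntegral.integral_comp_div
    (fun v : ℝ ↦ (digamma ((1 / 4 : ℝ) + v * I)).re) (a := 0) (b := t) two_ne_zero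
  simp only [zero_div] at hsub
  have e : (fun u : ℝ ↦ (digamma (1 / 4 + u / 2 * I)).re) =
      fun u ↦ (digamma (((1 / 4 : ℝ) : ℂ) + ((u / 2 : ℝ) : ℂ) * I)).re := by
    funext u; push_cast; ring_nf
  rw [e, hsub]
  simp
  ring

/-- **Duplication for the vertical arguments**: for `σ > 0`,
`argGammaVert σ τ + argGammaVert (σ + ½) τ = argGammaVert (2σ) (2τ) − 2τ log 2`
(integrate `Re` of `digamma_add_digamma_add_half` along `u ↦ σ + iu`). [folklore] -/
theorem argGammaVert_add_argGammaVert_add_half {σ : ℝ} (hσ : 0 < σ) (τ : ℝ) :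
    argGammaVert σ τ + argGammaVert (σ + 1 / 2) τ = argGammaVert (2 * σ) (2 * τ) - 2 * τ * Real.log 2 := by
  have hσ' : 0 < σ + 1 / 2 := by linarith
  have h2σ : 0 < 2 * σ := by linarith
  simp only [argGammaVert]
  rw [← intervalIntegral.integral_add ((continuous_re_digamma_vertical hσ).intervalIntegrable _ _)
    ((continuous_re_digamma_vertical hσ').intervalIntegrable _ _)]
  have hsub := intervalIntegral.integral_comp_mul_left
    (fun v : ℝ ↦ (digamma ((2 * σ : ℝ) + v * I)).re) (a := 0) (b := τ) two_ne_zero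
  simp only [mul_zero] at hsub
  -- pointwise duplication
  have hpt : ∀ u : ℝ, (digamma (σ + u * I)).re + (digamma ((σ + 1 / 2 : ℝ) + u * I)).re =
      2 * (digamma ((2 * σ : ℝ) + (2 * u : ℝ) * I)).re - 2 * Real.log 2 := by
    intro u
    have h := digamma_add_digamma_add_half (s := σ + u * I) (by simpa using hσ)
    have e1 : (σ : ℂ) + u * I + 1 / 2 = ((σ + 1 / 2 : ℝ) : ℂ) + u * I := by push_cast; ring
    have e2 : 2 * ((σ : ℂ) + u * I) = ((2 * σ : ℝ) : ℂ) + ((2 * u : ℝ) : ℂ) * I := by push_cast; ring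
    rw [e1, e2] at h
    have := congrArg Complex.re h
    simp only [add_re, sub_re, mul_re, re_ofNat, im_ofNat, ofReal_re, ofReal_im] at this
    linarith
  set Fd : ℝ → ℝ := fun v ↦ (digamma (((2 * σ : ℝ) : ℂ) + v * I)).re with hFd
  have hFc : Continuous Fd := continuous_re_digamma_vertical h2σ
  have hcomp : Continuous fun u : ℝ ↦ Fd (2 * u) := hFc.comp (continuous_const.mul continuous_id)
  have hpt' : ∀ u : ℝ, (digamma (σ + u * I)).re + (digamma ((σ + 1 / 2 : ℝ) + u * I)).re =
      2 * Fd (2 * u) - 2 * Real.log 2 := fun u ↦ by rw [hpt u]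
  rw [intervalIntegral.integral_congr fun u _ ↦ hpt' u,
    intervalIntegral.integral_sub ((hcomp.const_mul 2).intervalIntegrable _ _)
      (continuous_const.intervalIntegrable _ _),
    intervalIntegral.integral_const, intervalIntegral.integral_const_mul, hsub]
  simp
  ring

/-! ### Reflection for the vertical arguments -/

/-- `Re sin(x + iy) = sin x · cosh y`. [folklore] -/
theorem sin_add_mul_I_re (x y : ℝ) : (Complex.sin (x + y * I)).re = Real.sin x * Real.cosh y := by
  rw [Complex.sin_eq]
  simp [← ofReal_sin, ← ofReal_cosh, ← ofReal_cos, ← ofReal_sinh]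

/-- `Im sin(x + iy) = cos x · sinh y`. [folklore] -/
theorem sin_add_mul_I_im (x y : ℝ) : (Complex.sin (x + y * I)).im = Real.cos x * Real.sinh y := by
  rw [Complex.sin_eq]
  simp [← ofReal_sin, ← ofReal_cosh, ← ofReal_cos, ← ofReal_sinh]

/-- For `0 < σ < 1`, `sin(π(σ + iu))` has positive real part (so lies in the slit plane). [folklore] -/
theorem sin_pi_mul_re_pos {σ : ℝ} (h0 : 0 < σ) (h1 : σ < 1) (u : ℝ) :
    0 < (Complex.sin (π * (σ + u * I))).re := by
  have e : (π : ℂ) * (σ + u * I) = ((π * σ : ℝ) : ℂ) + ((π * u : ℝ) : ℂ) * I := by push_cast; ring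
  rw [e, sin_add_mul_I_re]
  exact mul_pos (Real.sin_pos_of_pos_of_lt_pi (by positivity) (by nlinarith [Real.pi_pos]))
    (Real.cosh_pos _)

/-- Imaginary parts: `(Im f)' = Im f'` for `f : ℝ → ℂ`. [folklore] -/
lemma hasDerivAt_im_comp {f : ℝ → ℂ} {f' : ℂ} {u : ℝ} (hf : HasDerivAt f f' u) :
    HasDerivAt (fun u ↦ (f u).im) f'.im u := by
  exact imCLM.hasFDerivAt.comp_hasDerivAt u hf

/-- `d/du Im log sin(π(σ+iu)) = Re (π cos(πz)/sin(πz))`, `z = σ + iu`, for `0 < σ < 1`. [folklore] -/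
theorem hasDerivAt_im_log_sin {σ : ℝ} (h0 : 0 < σ) (h1 : σ < 1) (u : ℝ) :
    HasDerivAt (fun u : ℝ ↦ (Complex.log (Complex.sin (π * (σ + u * I)))).im)
      ((π * Complex.cos (π * (σ + u * I)) / Complex.sin (π * (σ + u * I))).re) u := by
  have hlin : HasDerivAt (fun w : ℂ ↦ (π : ℂ) * (σ + w * I)) (π * I) (u : ℂ) := by
    have := (((hasDerivAt_id (u : ℂ)).mul_const I).const_add (σ : ℂ)).const_mul (π : ℂ)
    simpa using this
  have hsin : HasDerivAt (fun w : ℂ ↦ Complex.sin (π * (σ + w * I)))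
      (Complex.cos (π * (σ + u * I)) * (π * I)) (u : ℂ) :=
    (Complex.hasDerivAt_sin _).comp (u : ℂ) hlin
  have hslit : Complex.sin (π * (σ + u * I)) ∈ slitPlane := Or.inl (sin_pi_mul_re_pos h0 h1 u)
  have hlog := (hsin.clog hslit).comp_ofReal
  have him := hasDerivAt_im_comp hlog
  convert him using 1
  rw [show Complex.cos (π * (σ + u * I)) * (π * I) / Complex.sin (π * (σ + u * I)) =
      (π * Complex.cos (π * (σ + u * I)) / Complex.sin (π * (σ + u * I))) * I by ring]
  simp

/-- **Reflection for the vertical arguments**: for `0 < σ < 1` and all `τ`,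
`argGammaVert σ τ − argGammaVert (1−σ) τ = −Im log sin(π(σ + iτ)) = −arg sin(π(σ+iτ))`
(integrate `Re` of `digamma_sub_digamma_one_sub` along `u ↦ σ + iu`, using
`Re ψ((1−σ)+iu) = Re ψ(1 − (σ+iu))` by conjugation symmetry). [folklore] -/
theorem argGammaVert_sub_argGammaVert_one_sub {σ : ℝ} (h0 : 0 < σ) (h1 : σ < 1) (τ : ℝ) :
    argGammaVert σ τ - argGammaVert (1 - σ) τ =
      -(Complex.log (Complex.sin (π * (σ + τ * I)))).im := by
  have h1' : 0 < 1 - σ := by linarith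
  set Φ : ℝ → ℝ := fun u ↦ argGammaVert σ u - argGammaVert (1 - σ) u +
    (Complex.log (Complex.sin (π * (σ + u * I)))).im with hΦ
  have hderiv : ∀ u, HasDerivAt Φ 0 u := by
    intro u
    have hA := hasDerivAt_argGammaVert h0 u
    have hB := hasDerivAt_argGammaVert h1' u
    have hC := hasDerivAt_im_log_sin h0 h1 u
    have hsum := (hA.sub hB).add hC
    refine hsum.congr_deriv ?_
    -- the pointwise identity
    have hz : 0 < ((σ : ℂ) + u * I).re := by simpa using h0
    have hz1 : ((σ : ℂ) + u * I).re < 1 := by simpa using h1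
    have hrefl := congrArg Complex.re (digamma_sub_digamma_one_sub hz hz1)
    have hconj : (digamma (((1 - σ : ℝ) : ℂ) + u * I)).re = (digamma (1 - ((σ : ℂ) + u * I))).re := by
      have e : 1 - ((σ : ℂ) + u * I) = conj (((1 - σ : ℝ) : ℂ) + u * I) := by
        apply Complex.ext <;> simp
      rw [e, digamma_conj, conj_re]
    rw [sub_re] at hrefl
    rw [hconj, neg_re] at *
    linarith
  have hconst := is_const_of_deriv_eq_zero (fun u ↦ (hderiv u).differentiableAt)
    (fun u ↦ (hderiv u).deriv) τ 0
  have hΦ0 : Φ 0 = 0 := by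
    simp only [hΦ, argGammaVert_zero, ofReal_zero, zero_mul, add_zero, sub_self, zero_add]
    rw [Complex.log_im, ← Complex.ofReal_mul, ← Complex.ofReal_sin, Complex.arg_ofReal_of_nonneg]
    exact (Real.sin_pos_of_pos_of_lt_pi (by positivity) (by nlinarith [Real.pi_pos])).le
  rw [hΦ0] at hconst
  simp only [hΦ] at hconst
  linarith

/-! ### Asymptotics on a fixed vertical line: `arg Γ(σ+iτ) = τ log τ − τ + c(σ) + O(1/τ)` -/

/-- The Stirling remainder rate on the line `Re s = σ`: `K(σ) = 1/6 + π/12 + σ²/2 + σ/2`, an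
admissible constant in `|Re ψ(σ+iu) − log u| ≤ K(σ)/u²` (`u ≥ 1`) and in
`arg Γ(σ+iτ) = τ log τ − τ + c(σ) + O(K(σ)/τ)`. (Not optimal.) [folklore] -/
def stirlingVertRate (σ : ℝ) : ℝ := 1 / 6 + π / 12 + σ ^ 2 / 2 + σ / 2

/-- **`|Re ψ(σ + iu) − log u| ≤ K(σ)/u²`** for `σ > 0`, `u ≥ 1` (from the second-order bound
`abs_re_digamma_sub_log_norm_add_re_le`, `log ‖σ+iu‖ − log u = ½ log(1 + σ²/u²) ≤ σ²/(2u²)`,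
`Re 1/(2(σ+iu)) = σ/(2(σ²+u²))`). [folklore] -/
theorem abs_re_digamma_vertical_sub_log_le {σ u : ℝ} (hσ : 0 < σ) (hu : 1 ≤ u) :
    |(digamma (σ + u * I)).re - Real.log u| ≤ stirlingVertRate σ / u ^ 2 := by
  set w : ℂ := σ + u * I with hw
  have hwre : w.re = σ := by simp [hw]
  have hwim : w.im = u := by simp [hw]
  have hu0 : 0 < u := by linarith
  have h1 := abs_re_digamma_sub_log_norm_add_re_le (w := w) (by rw [hwre]; exact hσ)
    (by rw [hwim]; exact hu0.ne')
  rw [hwim, abs_of_pos hu0] at h1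
  -- `log ‖w‖ − log u`
  have hnorm2 : ‖w‖ ^ 2 = σ ^ 2 + u ^ 2 := by
    rw [Complex.sq_norm, Complex.normSq_apply, hwre, hwim]; ring
  have hlogw : Real.log ‖w‖ = Real.log (σ ^ 2 + u ^ 2) / 2 := by
    have : Real.log (‖w‖ ^ 2) = 2 * Real.log ‖w‖ := by rw [Real.log_pow]; norm_num
    rw [hnorm2] at this
    linarith
  have hlogu : Real.log (u ^ 2) = 2 * Real.log u := by rw [Real.log_pow]; norm_num
  have hratio : Real.log (σ ^ 2 + u ^ 2) - Real.log (u ^ 2) = Real.log ((σ ^ 2 + u ^ 2) / u ^ 2) :=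
    (Real.log_div (by positivity) (by positivity)).symm
  have hA0 : 0 ≤ Real.log ‖w‖ - Real.log u := by
    have : 0 ≤ Real.log ((σ ^ 2 + u ^ 2) / u ^ 2) :=
      Real.log_nonneg (by rw [le_div_iff₀ (by positivity)]; nlinarith)
    linarith
  have hA1 : Real.log ‖w‖ - Real.log u ≤ σ ^ 2 / (2 * u ^ 2) := by
    have := Real.log_le_sub_one_of_pos (x := (σ ^ 2 + u ^ 2) / u ^ 2) (by positivity)
    have e : (σ ^ 2 + u ^ 2) / u ^ 2 - 1 = σ ^ 2 / u ^ 2 := by field_simp; ring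
    rw [e] at this
    have e2 : σ ^ 2 / (2 * u ^ 2) = (σ ^ 2 / u ^ 2) / 2 := by ring
    rw [e2]
    linarith
  -- `Re 1/(2w)`
  have hB : (1 / (2 * w)).re = σ / (2 * (σ ^ 2 + u ^ 2)) := by
    have hden : σ ^ 2 + u ^ 2 ≠ 0 := by positivity
    rw [one_div, Complex.inv_re, Complex.normSq_apply]
    simp [hw]
    field_simp
  have hB0 : 0 ≤ (1 / (2 * w)).re := by rw [hB]; positivity
  have hB1 : (1 / (2 * w)).re ≤ σ / (2 * u ^ 2) := by
    rw [hB]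
    apply div_le_div_of_nonneg_left hσ.le (by positivity)
    nlinarith
  -- `1/u³ ≤ 1/u²`
  have hu3 : 1 / (6 * u ^ 3) ≤ 1 / (6 * u ^ 2) := by
    apply div_le_div_of_nonneg_left (by norm_num) (by positivity)
    nlinarith
  have key : |(digamma w).re - Real.log u| ≤
      (1 / (6 * u ^ 3) + π / (12 * u ^ 2)) + σ ^ 2 / (2 * u ^ 2) + σ / (2 * u ^ 2) := by
    have e : (digamma w).re - Real.log u =
        ((digamma w).re - Real.log ‖w‖ + (1 / (2 * w)).re) + (Real.log ‖w‖ - Real.log u) -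
          (1 / (2 * w)).re := by ring
    rw [e]
    have t1 := abs_add_le (((digamma w).re - Real.log ‖w‖ + (1 / (2 * w)).re) +
      (Real.log ‖w‖ - Real.log u)) (-(1 / (2 * w)).re)
    have t2 := abs_add_le ((digamma w).re - Real.log ‖w‖ + (1 / (2 * w)).re)
      (Real.log ‖w‖ - Real.log u)
    rw [abs_of_nonneg hA0] at t2
    rw [abs_neg, abs_of_nonneg hB0] at t1
    rw [sub_eq_add_neg]
    linarith
  have e : stirlingVertRate σ / u ^ 2 =
      1 / (6 * u ^ 2) + π / (12 * u ^ 2) + σ ^ 2 / (2 * u ^ 2) + σ / (2 * u ^ 2) := by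
    rw [stirlingVertRate]
    field_simp
  rw [e]
  linarith

/-- The Stirling remainder integrand `u ↦ Re ψ(σ+iu) − log u` is continuous on `(0, ∞)`. [folklore] -/
theorem continuousOn_re_digamma_vertical_sub_log {σ : ℝ} (hσ : 0 < σ) :
    ContinuousOn (fun u : ℝ ↦ (digamma (σ + u * I)).re - Real.log u) (Ioi 0) :=
  (continuous_re_digamma_vertical hσ).continuousOn.sub
    (Real.continuousOn_log.mono fun _ hu ↦ ne_of_gt hu)

/-- The Stirling remainder integrand is integrable on `(a, ∞)` for `a ≥ 1` (bounded by `K(σ)/u²`).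
[folklore] -/
theorem integrableOn_re_digamma_vertical_sub_log {σ a : ℝ} (hσ : 0 < σ) (ha : 1 ≤ a) :
    IntegrableOn (fun u : ℝ ↦ (digamma (σ + u * I)).re - Real.log u) (Ioi a) := by
  have hint : IntegrableOn (fun u : ℝ ↦ stirlingVertRate σ * u ^ (-2 : ℝ)) (Ioi a) :=
    ((integrableOn_Ioi_rpow_of_lt (by norm_num) (by linarith)).const_mul _)
  refine hint.mono' ((continuousOn_re_digamma_vertical_sub_log hσ).mono
    (fun u hu ↦ lt_of_lt_of_le (by linarith) (le_of_lt hu)) |>.aestronglyMeasurable measurableSet_Ioi) ?_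
  refine (ae_restrict_iff' measurableSet_Ioi).2 (Eventually.of_forall fun u hu ↦ ?_)
  have hu1 : 1 ≤ u := ha.trans (le_of_lt hu)
  have := abs_re_digamma_vertical_sub_log_le hσ hu1
  rw [Real.norm_eq_abs]
  refine this.trans (le_of_eq ?_)
  rw [Real.rpow_neg (by linarith), Real.rpow_two, div_eq_mul_inv]

/-- **Stirling's constant on the line `Re s = σ`**: `c(σ) = lim_{τ→∞} (arg Γ(σ+iτ) − (τ log τ − τ))`,
*defined* as `E(1) + ∫₁^∞ E'(u) du` with `E(τ) = argGammaVert σ τ − (τ log τ − τ)`,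
`E'(u) = Re ψ(σ+iu) − log u` (absolutely convergent); `tendsto_argGammaVert_sub` identifies it as the
limit, and `stirlingArgConst_one_quarter` computes `c(¼) = −π/8` (Stirling: `c(σ) = (σ − ½)π/2`).
[folklore] -/
def stirlingArgConst (σ : ℝ) : ℝ :=
  (argGammaVert σ 1 + 1) + ∫ u in Ioi (1 : ℝ), ((digamma (σ + u * I)).re - Real.log u)

/-- `E(τ) = argGammaVert σ τ − (τ log τ − τ)` has derivative `Re ψ(σ+iτ) − log τ` (`τ > 0`). [folklore] -/
theorem hasDerivAt_argGammaVert_sub {σ : ℝ} (hσ : 0 < σ) {τ : ℝ} (hτ : 0 < τ) :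
    HasDerivAt (fun τ : ℝ ↦ argGammaVert σ τ - (τ * Real.log τ - τ))
      ((digamma (σ + τ * I)).re - Real.log τ) τ := by
  have h1 := hasDerivAt_argGammaVert hσ τ
  have h2 := ((Real.hasDerivAt_mul_log hτ.ne').sub (hasDerivAt_id τ))
  exact (h1.sub h2).congr_deriv (by ring)

/-- **`arg Γ(σ + iτ) = τ log τ − τ + c(σ) + O(1/τ)`**: for `σ > 0` and `τ ≥ 1`,
`|argGammaVert σ τ − (τ log τ − τ) − c(σ)| ≤ K(σ)/τ`. (First two terms of Stirling's series for
`Im log Γ` on a vertical line; Titchmarsh §4.42, Whittaker–Watson §13.6.) [folklore] -/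
theorem abs_argGammaVert_sub_stirling_le {σ : ℝ} (hσ : 0 < σ) {τ : ℝ} (hτ : 1 ≤ τ) :
    |argGammaVert σ τ - (τ * Real.log τ - τ) - stirlingArgConst σ| ≤ stirlingVertRate σ / τ := by
  set E : ℝ → ℝ := fun τ ↦ argGammaVert σ τ - (τ * Real.log τ - τ) with hE
  set E' : ℝ → ℝ := fun u ↦ (digamma (σ + u * I)).re - Real.log u with hE'
  have hτ0 : 0 < τ := by linarith
  -- FTC on `[1, τ]`
  have hFTC : ∫ u in (1 : ℝ)..τ, E' u = E τ - E 1 := by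
    refine intervalIntegral.integral_eq_sub_of_hasDerivAt (fun u hu ↦ ?_) ?_
    · rw [uIcc_of_le hτ] at hu
      exact hasDerivAt_argGammaVert_sub hσ (by linarith [hu.1])
    · refine ContinuousOn.intervalIntegrable ?_
      rw [uIcc_of_le hτ]
      exact (continuousOn_re_digamma_vertical_sub_log hσ).mono fun u hu ↦ by
        simp only [mem_Ioi]; linarith [hu.1]
  -- splitting the improper integral at `τ`
  have hI1 := integrableOn_re_digamma_vertical_sub_log (σ := σ) (a := 1) hσ le_rfl
  have hIτ := integrableOn_re_digamma_vertical_sub_log hσ hτ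
  have hsplit : ∫ u in Ioi (1 : ℝ), E' u = (∫ u in (1 : ℝ)..τ, E' u) + ∫ u in Ioi τ, E' u := by
    rw [intervalIntegral.integral_of_le hτ, ← setIntegral_union (Ioc_disjoint_Ioi le_rfl)
      measurableSet_Ioi (hI1.mono_set Ioc_subset_Ioi_self) hIτ, Ioc_union_Ioi_eq_Ioi hτ]
  have hE1 : E 1 = argGammaVert σ 1 + 1 := by simp [hE]
  have hc : stirlingArgConst σ = E 1 + ∫ u in Ioi (1 : ℝ), E' u := by
    rw [stirlingArgConst, hE1]
  -- tail bound
  have htail : |∫ u in Ioi τ, E' u| ≤ stirlingVertRate σ / τ := by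
    have hg : IntegrableOn (fun u : ℝ ↦ stirlingVertRate σ * u ^ (-2 : ℝ)) (Ioi τ) :=
      (integrableOn_Ioi_rpow_of_lt (by norm_num) hτ0).const_mul _
    have hle := norm_integral_le_of_norm_le (μ := volume.restrict (Ioi τ)) hg
      ((ae_restrict_iff' measurableSet_Ioi).2 (Eventually.of_forall fun u hu ↦ by
        have hu1 : 1 ≤ u := hτ.trans (le_of_lt hu)
        have := abs_re_digamma_vertical_sub_log_le hσ hu1
        rw [Real.norm_eq_abs]
        refine this.trans (le_of_eq ?_)
        rw [Real.rpow_neg (by linarith), Real.rpow_two, div_eq_mul_inv]))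
    rw [Real.norm_eq_abs] at hle
    refine hle.trans (le_of_eq ?_)
    rw [MeasureTheory.integral_const_mul, integral_Ioi_rpow_of_lt (by norm_num) hτ0]
    have : τ ^ ((-2 : ℝ) + 1) = τ⁻¹ := by
      rw [show (-2 : ℝ) + 1 = -1 by norm_num, Real.rpow_neg_one]
    rw [this]
    field_simp
    norm_num
  have hmain : E τ - stirlingArgConst σ = -∫ u in Ioi τ, E' u := by
    rw [hc, hsplit, hFTC]; ring
  show |E τ - stirlingArgConst σ| ≤ _
  rw [hmain, abs_neg]
  exact htail

/-- `arg Γ(σ+iτ) − (τ log τ − τ) → c(σ)` as `τ → ∞`. [folklore] -/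
theorem tendsto_argGammaVert_sub {σ : ℝ} (hσ : 0 < σ) :
    Tendsto (fun τ : ℝ ↦ argGammaVert σ τ - (τ * Real.log τ - τ)) atTop
      (𝓝 (stirlingArgConst σ)) := by
  have hK : 0 ≤ stirlingVertRate σ := by
    rw [stirlingVertRate]; positivity
  have hlim : Tendsto (fun τ : ℝ ↦ stirlingVertRate σ / τ) atTop (𝓝 0) :=
    tendsto_const_nhds.div_atTop tendsto_id
  refine (tendsto_iff_norm_sub_tendsto_zero.2 ?_)
  refine squeeze_zero_norm' ?_ hlim
  filter_upwards [eventually_ge_atTop (1 : ℝ)] with τ hτ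
  simp only [Real.norm_eq_abs, abs_abs]
  exact abs_argGammaVert_sub_stirling_le hσ hτ

/-! ### The constants: duplication and reflection pin down `c(¼) = −π/8` -/

/-- `c(σ) + c(σ + ½) = c(2σ)` (`σ > 0`): limit of the exact duplication identity
`argGammaVert_add_argGammaVert_add_half`. [folklore] -/
theorem stirlingArgConst_add_stirlingArgConst_add_half {σ : ℝ} (hσ : 0 < σ) :
    stirlingArgConst σ + stirlingArgConst (σ + 1 / 2) = stirlingArgConst (2 * σ) := by
  have hσ' : 0 < σ + 1 / 2 := by linarith
  have h2σ : 0 < 2 * σ := by linarith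
  have hA := tendsto_argGammaVert_sub hσ
  have hB := tendsto_argGammaVert_sub hσ'
  have h2τ : Tendsto (fun τ : ℝ ↦ 2 * τ) atTop atTop := Tendsto.const_mul_atTop two_pos tendsto_id
  have hC := (tendsto_argGammaVert_sub h2σ).comp h2τ
  have heq : ∀ᶠ τ : ℝ in atTop,
      ((fun τ : ℝ ↦ argGammaVert (2 * σ) τ - (τ * Real.log τ - τ)) ∘ fun τ : ℝ ↦ 2 * τ) τ =
        (argGammaVert σ τ - (τ * Real.log τ - τ)) +
          (argGammaVert (σ + 1 / 2) τ - (τ * Real.log τ - τ)) := by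
    filter_upwards [eventually_gt_atTop (0 : ℝ)] with τ hτ
    simp only [Function.comp_apply]
    have hlog : Real.log (2 * τ) = Real.log 2 + Real.log τ :=
      Real.log_mul two_ne_zero hτ.ne'
    have hdup := argGammaVert_add_argGammaVert_add_half hσ τ
    rw [hlog]
    linarith
  exact (tendsto_nhds_unique (hC.congr' heq) (hA.add hB)).symm

/-- `sin(π(¼ + iτ)) = (√2 e^{πτ}/4) · ((1 + i) + e^{−2πτ}(1 − i))`. [folklore] -/
theorem sin_pi_mul_quarter_add (τ : ℝ) :
    Complex.sin (π * ((1 / 4 : ℝ) + τ * I)) =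
      ((Real.sqrt 2 * Real.exp (π * τ) / 4 : ℝ) : ℂ) *
        ((1 + I) + (Real.exp (-(2 * (π * τ))) : ℂ) * (1 - I)) := by
  have e : (π : ℂ) * ((1 / 4 : ℝ) + τ * I) = ((π / 4 : ℝ) : ℂ) + ((π * τ : ℝ) : ℂ) * I := by
    push_cast; ring
  set y : ℝ := π * τ with hy
  have hexp : Real.exp (-(2 * y)) = Real.exp (-y) * Real.exp (-y) := by
    rw [← Real.exp_add]; ring_nf
  have hexp2 : Real.exp y * Real.exp (-y) = 1 := by rw [← Real.exp_add]; simp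
  rw [e]
  have hab : Real.exp y * (Real.exp (-y) * Real.exp (-y)) = Real.exp (-y) := by
    rw [← mul_assoc, hexp2, one_mul]
  apply Complex.ext
  · rw [sin_add_mul_I_re, Real.sin_pi_div_four, Real.cosh_eq]
    simp only [mul_re, ofReal_re, ofReal_im, add_re, one_re, I_re, sub_re, add_im, one_im, I_im,
      sub_im, mul_im, zero_mul, sub_zero, add_zero, zero_add, mul_one]
    rw [hexp]
    linear_combination (-(Real.sqrt 2 / 4)) * hab
  · rw [sin_add_mul_I_im, Real.cos_pi_div_four, Real.sinh_eq]
    simp only [mul_re, ofReal_re, ofReal_im, add_re, one_re, I_re, sub_re, add_im, one_im, I_im,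
      sub_im, mul_im, zero_mul, sub_zero, add_zero, zero_add, mul_one]
    rw [hexp]
    linear_combination (Real.sqrt 2 / 4) * hab

/-- `arg(1 + i) = π/4`. [folklore] -/
theorem arg_one_add_I : arg (1 + I) = π / 4 := by
  have h1 : Real.tan (arg (1 + I)) = 1 := by rw [tan_arg]; simp
  have h2 : |arg (1 + I)| < π / 2 := abs_arg_lt_pi_div_two_iff.2 (Or.inl (by simp))
  rw [← Real.arctan_one, ← h1, Real.arctan_tan (abs_lt.1 h2).1 (abs_lt.1 h2).2]

/-- `arg sin(π(¼ + iτ)) → π/4` as `τ → ∞`. [folklore] -/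
theorem tendsto_arg_sin_quarter :
    Tendsto (fun τ : ℝ ↦ (Complex.log (Complex.sin (π * ((1 / 4 : ℝ) + τ * I)))).im) atTop
      (𝓝 (π / 4)) := by
  have hq : Tendsto (fun τ : ℝ ↦ (1 + I) + (Real.exp (-(2 * (π * τ))) : ℂ) * (1 - I)) atTop
      (𝓝 ((1 + I) + (0 : ℝ) * (1 - I))) := by
    have h1 : Tendsto (fun τ : ℝ ↦ Real.exp (-(2 * (π * τ)))) atTop (𝓝 0) := by
      refine Real.tendsto_exp_atBot.comp ?_
      have : Tendsto (fun τ : ℝ ↦ 2 * (π * τ)) atTop atTop :=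
        Tendsto.const_mul_atTop two_pos (Tendsto.const_mul_atTop Real.pi_pos tendsto_id)
      exact tendsto_neg_atTop_atBot.comp this
    have h2 : Tendsto (fun τ : ℝ ↦ (Real.exp (-(2 * (π * τ))) : ℂ)) atTop (𝓝 ((0 : ℝ) : ℂ)) :=
      (continuous_ofReal.tendsto _).comp h1
    exact tendsto_const_nhds.add (h2.mul tendsto_const_nhds)
  simp only [ofReal_zero, zero_mul, add_zero] at hq
  have hslit : (1 : ℂ) + I ∈ slitPlane := Or.inl (by simp)
  have harg := ((continuousAt_arg hslit).tendsto.comp hq)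
  rw [arg_one_add_I] at harg
  refine harg.congr fun τ ↦ ?_
  simp only [Function.comp_apply]
  rw [Complex.log_im, sin_pi_mul_quarter_add, arg_real_mul]
  positivity

/-- `c(¼) − c(¾) = −π/4`: limit of the reflection identity
`argGammaVert_sub_argGammaVert_one_sub` at `σ = ¼` (`arg sin(π(¼+iτ)) → π/4`). [folklore] -/
theorem stirlingArgConst_quarter_sub :
    stirlingArgConst (1 / 4) - stirlingArgConst (3 / 4) = -(π / 4) := by
  have hA := tendsto_argGammaVert_sub (σ := 1 / 4) (by norm_num)
  have hB := tendsto_argGammaVert_sub (σ := 3 / 4) (by norm_num)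
  have hC := tendsto_arg_sin_quarter.neg
  have heq : ∀ τ : ℝ, (argGammaVert (1 / 4) τ - (τ * Real.log τ - τ)) -
      (argGammaVert (3 / 4) τ - (τ * Real.log τ - τ)) =
        -(Complex.log (Complex.sin (π * ((1 / 4 : ℝ) + τ * I)))).im := by
    intro τ
    have h := argGammaVert_sub_argGammaVert_one_sub (σ := 1 / 4) (by norm_num) (by norm_num) τ
    rw [show (1 : ℝ) - 1 / 4 = 3 / 4 by norm_num] at h
    push_cast at h ⊢
    linarith
  have := tendsto_nhds_unique ((hA.sub hB).congr heq) hC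
  linarith

/-- **`c(¼) = −π/8`** (Stirling: `arg Γ(σ+iτ) = τ log τ − τ + (σ − ½)π/2 + O(1/τ)`), from
`c(½) + c(1) = c(1)` (so `c(½) = 0`), `c(¼) + c(¾) = c(½)` and `c(¼) − c(¾) = −π/4`. [folklore] -/
theorem stirlingArgConst_one_quarter : stirlingArgConst (1 / 4) = -(π / 8) := by
  have h1 := stirlingArgConst_add_stirlingArgConst_add_half (σ := 1 / 2) (by norm_num)
  have h2 := stirlingArgConst_add_stirlingArgConst_add_half (σ := 1 / 4) (by norm_num)
  have h3 := stirlingArgConst_quarter_sub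
  norm_num at h1 h2 h3
  linarith

/-! ### Stirling's formula for `θ` -/

/-- **Explicit Stirling bound for `θ`**: for `t ≥ 2`,
`|θ(t) − ((t/2) log(t/2π) − t/2 − π/8)| ≤ 2K(¼)/t`. (Titchmarsh §4.17; Edwards §6.5 (6.5.3).)
[folklore] -/
theorem abs_riemannSiegelTheta_sub_stirling_le {t : ℝ} (ht : 2 ≤ t) :
    |riemannSiegelTheta t - (t / 2 * Real.log (t / (2 * π)) - t / 2 - π / 8)| ≤
      2 * stirlingVertRate (1 / 4) / t := by
  have hτ : 1 ≤ t / 2 := by linarith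
  have h := abs_argGammaVert_sub_stirling_le (σ := 1 / 4) (by norm_num) hτ
  rw [stirlingArgConst_one_quarter] at h
  have hlog : Real.log (t / 2) - Real.log π = Real.log (t / (2 * π)) := by
    rw [← Real.log_div (by positivity) Real.pi_ne_zero, div_div]
  have e : riemannSiegelTheta t - (t / 2 * Real.log (t / (2 * π)) - t / 2 - π / 8) =
      argGammaVert (1 / 4) (t / 2) - (t / 2 * Real.log (t / 2) - t / 2) - -(π / 8) := by
    rw [riemannSiegelTheta_eq_argGammaVert, ← hlog]
    ring
  rw [e]
  refine h.trans (le_of_eq ?_)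
  field_simp

/-- **Stirling's formula for `θ`** — discharge of the named fact
`Literature.NumberTheory.LFunctions.isBigO_riemannSiegelTheta_sub_stirling` (`RiemannSiegel.lean`):
`θ(t) = (t/2) log(t/2π) − t/2 − π/8 + O(1/t)`. (Titchmarsh §4.17; Edwards §6.5, eq. (6.5.3).)
[folklore] -/
theorem isBigO_riemannSiegelTheta_sub_stirling_holds : isBigO_riemannSiegelTheta_sub_stirling := by
  rw [isBigO_riemannSiegelTheta_sub_stirling, Asymptotics.isBigO_iff]
  refine ⟨2 * stirlingVertRate (1 / 4), ?_⟩
  filter_upwards [eventually_ge_atTop (2 : ℝ)] with t ht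
  rw [Real.norm_eq_abs, Real.norm_eq_abs, abs_of_pos (inv_pos.2 (by linarith : (0 : ℝ) < t)), ← div_eq_mul_inv]
  exact abs_riemannSiegelTheta_sub_stirling_le ht

/-- **Backlund's refinement of the Riemann–von Mangoldt formula** — discharge of the named fact
`Literature.NumberTheory.LFunctions.isBigO_zetaZeroCount_sub_backlund` (`ZeroCounting.lean`):
`N(T) = (T/2π) log(T/2π) − T/2π + 7/8 + S(T) + O(1/T)` (bookkeeping
`Literature.NumberTheory.LFunctions.isBigO_zetaZeroCount_sub_backlund_of_stirling` + Stirling for `θ`). (Titchmarsh Thm. 9.3;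
Backlund 1918.) [folklore] -/
theorem isBigO_zetaZeroCount_sub_backlund_holds : isBigO_zetaZeroCount_sub_backlund :=
  isBigO_zetaZeroCount_sub_backlund_of_stirling isBigO_riemannSiegelTheta_sub_stirling_holds

end Literature.NumberTheory.LFunctions
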